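import Mathlib
import Summits.NavierStokesRegularity.NavierStokesRegularity.Theorems.FilamentSkeletonRssKelvinGateFreePressure
import Summits.NavierStokesRegularity.NavierStokesRegularity.Theorems.FilamentSkeletonRssKelvinGateFreeResolventDiv

/-!
# Route `FilamentSkeletonRss` · crux `TransverseReduction1A` (stmt-27414; successor of the aside `TransverseReductionRJ`,
# stmt-21221) — line `kelvin_gate`: the sharp-scale free Kelvin gate is a LINEAR right inverse

Helper file (theorems only, `--as helper`).  HONEST FRAMING: analysis bookkeeping for a HYPOTHETICAL filament-type rotating
self-similar blow-up route; nothing here bears on Navier–Stokes regularity; no stub is proved here.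

`…KelvinGateFreeGateSharp.free_kelvin_gate_sharp` gives, for every `F ∈ Y♯_a`, the EXPLICIT pair `(W[F], Q[F])` — free pressure
`Q[F] = Σⱼ T_{eⱼ}Fⱼ` and free OU resolvent `W[F]` of the projected datum `F − ∇Q[F]` — solving `𝓛_(α,0)W + ∇Q = F` in `X♯_a × C¹`
with norm `≤ C‖F‖_{Y♯_a}`.  A Kelvin GATE is a bounded LINEAR right inverse; this file records the linearity of the explicit formulas:

* `newtonGradPotential_add_smul` — `T_a(f + t g) = T_a f + t T_a g` for `⟨y⟩⁻²`-densities (absolute convergence);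
* `freePressure_add_smul`, `gradient_freePressure_add_smul` — `Q[F + tF′] = Q[F] + tQ[F′]`, `∇Q[F + tF′] = ∇Q[F] + t∇Q[F′]`;
* `free_kelvin_gate_sharp_linear` — **`W[F + tF′] = W[F] + tW[F′]`** and **`Q[F + tF′] = Q[F] + tQ[F′]`** pointwise, for
  `F, F′ ∈ C¹` with the quadratic weights `(1+|y|)²(‖F‖, ‖DF‖) ≤ R` (in particular for `F, F′ ∈ Y♯_a`), every rate `α`, every `t`.
-/

set_option linter.dupNamespace false

noncomputable section

namespace Summit.NavierStokesRegularity.NavierStokesRegularity.Theorems.KelvinGate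

open Set Function Filter Topology InnerProductSpace MeasureTheory Real Metric
open Literature.Analysis.FluidPDE Literature.Analysis.FluidPDE.NewtonPotentialHolder Literature.Analysis.UnboundedOperators
open scoped Laplacian RealInnerProductSpace ContDiff Topology ENNReal BigOperators

section Linear

variable {F F' : EuclideanSpace ℝ (Fin 3) → EuclideanSpace ℝ (Fin 3)} {R R' : ℝ}

/-- **`T_a(f + t g) = T_a f + t T_a g`** for measurable densities with `(1+|y|)²‖f‖ ≤ R₀`, `(1+|y|)²‖g‖ ≤ R₀′`. -/
theorem newtonGradPotential_add_smul {f g : EuclideanSpace ℝ (Fin 3) → ℝ} (hf : AEStronglyMeasurable f volume)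
    (hg : AEStronglyMeasurable g volume) {R₀ R₀' : ℝ} (h0 : ∀ y, (1 + ‖y‖) ^ 2 * ‖f y‖ ≤ R₀)
    (h0' : ∀ y, (1 + ‖y‖) ^ 2 * ‖g y‖ ≤ R₀') (t : ℝ) (a x : EuclideanSpace ℝ (Fin 3)) :
    newtonGradPotential a (fun y => f y + t * g y) x = newtonGradPotential a f x + t * newtonGradPotential a g x := by
  unfold newtonGradPotential
  have hI := integrable_fderiv_newtonKernel_smul_of_sq_weight hf h0 a x
  have hI' := integrable_fderiv_newtonKernel_smul_of_sq_weight hg h0' a x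
  have hIt : Integrable (fun y => t * (fderiv ℝ newtonKernel (x - y) a • g y)) (volume : Measure (EuclideanSpace ℝ (Fin 3))) :=
    hI'.const_mul t
  have hfun : (fun y => fderiv ℝ newtonKernel (x - y) a • (f y + t * g y)) =
      fun y => fderiv ℝ newtonKernel (x - y) a • f y + t * (fderiv ℝ newtonKernel (x - y) a • g y) := by
    funext y; simp only [smul_eq_mul]; ring
  rw [hfun, integral_add hI hIt, integral_const_mul]

/-- Coordinates of `F + tF′`. -/
theorem coord_add_smul (t : ℝ) (j : Fin 3) (y : EuclideanSpace ℝ (Fin 3)) :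
    (F y + t • F' y) j = F y j + t * F' y j := by
  simp

/-- **The free pressure is linear**: `Q[F + tF′](x) = Q[F](x) + t Q[F′](x)`. -/
theorem freePressure_add_smul (hF : Continuous F) (hF' : Continuous F') {R₀ R₀' : ℝ}
    (h0 : ∀ y, (1 + ‖y‖) ^ 2 * ‖F y‖ ≤ R₀) (h0' : ∀ y, (1 + ‖y‖) ^ 2 * ‖F' y‖ ≤ R₀') (t : ℝ) (x : EuclideanSpace ℝ (Fin 3)) :
    (∑ j : Fin 3, newtonGradPotential (EuclideanSpace.single j (1:ℝ)) (fun y => (F y + t • F' y) j) x) =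
      (∑ j : Fin 3, newtonGradPotential (EuclideanSpace.single j (1:ℝ)) (fun y => F y j) x) +
        t * ∑ j : Fin 3, newtonGradPotential (EuclideanSpace.single j (1:ℝ)) (fun y => F' y j) x := by
  rw [Finset.mul_sum, ← Finset.sum_add_distrib]
  refine Finset.sum_congr rfl fun j _ => ?_
  have hcf : Continuous fun y => F y j := (EuclideanSpace.proj (𝕜 := ℝ) j).continuous.comp hF
  have hcf' : Continuous fun y => F' y j := (EuclideanSpace.proj (𝕜 := ℝ) j).continuous.comp hF'
  have h := newtonGradPotential_add_smul hcf.aestronglyMeasurable hcf'.aestronglyMeasurable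
    (fun y => by rw [Real.norm_eq_abs]; exact sq_weight_abs_coord_le h0 j y)
    (fun y => by rw [Real.norm_eq_abs]; exact sq_weight_abs_coord_le h0' j y) t (EuclideanSpace.single j (1:ℝ)) x
  simp only [coord_add_smul]
  exact h

/-- **The free pressure gradient is linear**: `∇Q[F + tF′](x) = ∇Q[F](x) + t ∇Q[F′](x)` for `C¹` data with quadratic weights. -/
theorem gradient_freePressure_add_smul (hF : ContDiff ℝ 1 F) (hF' : ContDiff ℝ 1 F') {R₀ R₁ R₀' R₁' : ℝ}
    (h0 : ∀ y, (1 + ‖y‖) ^ 2 * ‖F y‖ ≤ R₀) (h1 : ∀ y, (1 + ‖y‖) ^ 2 * ‖fderiv ℝ F y‖ ≤ R₁)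
    (h0' : ∀ y, (1 + ‖y‖) ^ 2 * ‖F' y‖ ≤ R₀') (h1' : ∀ y, (1 + ‖y‖) ^ 2 * ‖fderiv ℝ F' y‖ ≤ R₁') (t : ℝ)
    (x : EuclideanSpace ℝ (Fin 3)) :
    gradient (fun x => ∑ j : Fin 3, newtonGradPotential (EuclideanSpace.single j (1:ℝ)) (fun y => (F y + t • F' y) j) x) x =
      gradient (fun x => ∑ j : Fin 3, newtonGradPotential (EuclideanSpace.single j (1:ℝ)) (fun y => F y j) x) x +
        t • gradient (fun x => ∑ j : Fin 3, newtonGradPotential (EuclideanSpace.single j (1:ℝ)) (fun y => F' y j) x) x := by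
  have hfun : (fun x => ∑ j : Fin 3, newtonGradPotential (EuclideanSpace.single j (1:ℝ)) (fun y => (F y + t • F' y) j) x) =
      fun x => (∑ j : Fin 3, newtonGradPotential (EuclideanSpace.single j (1:ℝ)) (fun y => F y j) x) +
        t * ∑ j : Fin 3, newtonGradPotential (EuclideanSpace.single j (1:ℝ)) (fun y => F' y j) x :=
    funext fun x => freePressure_add_smul hF.continuous hF'.continuous h0 h0' t x
  rw [hfun]
  have hd : DifferentiableAt ℝ (fun x => ∑ j : Fin 3, newtonGradPotential (EuclideanSpace.single j (1:ℝ)) (fun y => F y j) x) x :=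
    ((contDiff_one_freePressure hF h0 h1).differentiable one_ne_zero) x
  have hd' : DifferentiableAt ℝ (fun x => ∑ j : Fin 3, newtonGradPotential (EuclideanSpace.single j (1:ℝ)) (fun y => F' y j) x) x :=
    ((contDiff_one_freePressure hF' h0' h1').differentiable one_ne_zero) x
  unfold gradient
  rw [fderiv_fun_add hd (hd'.const_mul t), fderiv_const_mul hd', map_add, map_smul]

/-- **THE SHARP-SCALE FREE KELVIN GATE IS LINEAR.**  For `C¹` forcings `F, F′` with `(1+|y|)²(‖F‖, ‖DF‖) ≤ R` and
`(1+|y|)²(‖F′‖, ‖DF′‖) ≤ R′` (e.g. `F, F′ ∈ Y♯_a`), every rate `α` and every `t`, the explicit solution pair of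
`free_kelvin_gate_sharp` for the datum `F + tF′` is `(W[F] + tW[F′], Q[F] + tQ[F′])` pointwise. -/
theorem free_kelvin_gate_sharp_linear (hF : ContDiff ℝ 1 F) (hF' : ContDiff ℝ 1 F')
    (h0 : ∀ y, (1 + ‖y‖) ^ 2 * ‖F y‖ ≤ R) (h1 : ∀ y, (1 + ‖y‖) ^ 2 * ‖fderiv ℝ F y‖ ≤ R)
    (h0' : ∀ y, (1 + ‖y‖) ^ 2 * ‖F' y‖ ≤ R') (h1' : ∀ y, (1 + ‖y‖) ^ 2 * ‖fderiv ℝ F' y‖ ≤ R') (t α : ℝ)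
    (y : EuclideanSpace ℝ (Fin 3)) :
    (∫ s in Ioi (0:ℝ), (Real.exp (-(s / 2)) • rotZL (-(α * s)))
        (heatExtension (fun x => (F x + t • F' x) - gradient (fun x => ∑ j : Fin 3,
          newtonGradPotential (EuclideanSpace.single j (1:ℝ)) (fun y => (F y + t • F' y) j) x) x)
          (1 - Real.exp (-s)) ((Real.exp (-(s / 2)) • rotZL (α * s)) y))) =
      (∫ s in Ioi (0:ℝ), (Real.exp (-(s / 2)) • rotZL (-(α * s)))
        (heatExtension (fun x => F x - gradient (fun x => ∑ j : Fin 3,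
          newtonGradPotential (EuclideanSpace.single j (1:ℝ)) (fun y => F y j) x) x)
          (1 - Real.exp (-s)) ((Real.exp (-(s / 2)) • rotZL (α * s)) y))) +
      t • (∫ s in Ioi (0:ℝ), (Real.exp (-(s / 2)) • rotZL (-(α * s)))
        (heatExtension (fun x => F' x - gradient (fun x => ∑ j : Fin 3,
          newtonGradPotential (EuclideanSpace.single j (1:ℝ)) (fun y => F' y j) x) x)
          (1 - Real.exp (-s)) ((Real.exp (-(s / 2)) • rotZL (α * s)) y))) ∧
    (∑ j : Fin 3, newtonGradPotential (EuclideanSpace.single j (1:ℝ)) (fun y => (F y + t • F' y) j) y) =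
      (∑ j : Fin 3, newtonGradPotential (EuclideanSpace.single j (1:ℝ)) (fun y => F y j) y) +
        t * ∑ j : Fin 3, newtonGradPotential (EuclideanSpace.single j (1:ℝ)) (fun y => F' y j) y := by
  refine ⟨?_, freePressure_add_smul hF.continuous hF'.continuous h0 h0' t y⟩
  -- the projected data `G, G′` are bounded continuous, and `G[F + tF′] = G + tG′`
  set Q : EuclideanSpace ℝ (Fin 3) → ℝ := fun x => ∑ j : Fin 3,
    newtonGradPotential (EuclideanSpace.single j (1:ℝ)) (fun y => F y j) x with hQ
  set Q' : EuclideanSpace ℝ (Fin 3) → ℝ := fun x => ∑ j : Fin 3,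
    newtonGradPotential (EuclideanSpace.single j (1:ℝ)) (fun y => F' y j) x with hQ'
  have hQ1 : ContDiff ℝ 1 Q := contDiff_one_freePressure hF h0 h1
  have hQ1' : ContDiff ℝ 1 Q' := contDiff_one_freePressure hF' h0' h1'
  have hGc : Continuous fun x => F x - gradient Q x := hF.continuous.sub (continuous_gradient_of_contDiff hQ1)
  have hGc' : Continuous fun x => F' x - gradient Q' x := hF'.continuous.sub (continuous_gradient_of_contDiff hQ1')
  -- bounds: `‖F‖ ≤ R`, `‖∇Q‖ ≤ 3 (R/4π) 12V`
  have hFb : ∀ z, ‖F z‖ ≤ R := fun z => by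
    have h1' : 1 ≤ (1 + ‖z‖) ^ 2 := one_le_pow₀ (by linarith [norm_nonneg z])
    have := h0 z; nlinarith [norm_nonneg (F z)]
  have hFb' : ∀ z, ‖F' z‖ ≤ R' := fun z => by
    have h1' : 1 ≤ (1 + ‖z‖) ^ 2 := one_le_pow₀ (by linarith [norm_nonneg z])
    have := h0' z; nlinarith [norm_nonneg (F' z)]
  set V3 : ℝ := 3 * (volume : Measure (EuclideanSpace ℝ (Fin 3))).real (ball 0 1) with hV3
  have hDQ : ∀ z, ‖gradient Q z‖ ≤ 3 * (R / (4 * π) * (12 * V3)) := by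
    intro z
    have h := norm_fderiv_freePressure_le hF h0 h1 z
    have hz : (1:ℝ) ≤ 1 + ‖z‖ := by linarith [norm_nonneg z]
    have hR : 0 ≤ R := le_trans (by positivity) (h0 0)
    have hle : 12 * V3 / (1 + ‖z‖) ≤ 12 * V3 := div_le_self (by positivity) hz
    have : ‖gradient Q z‖ = ‖fderiv ℝ Q z‖ := by unfold gradient; exact LinearIsometryEquiv.norm_map _ _
    rw [this]
    exact h.trans (mul_le_mul_of_nonneg_left (mul_le_mul_of_nonneg_left hle (by positivity)) (by norm_num))
  have hDQ' : ∀ z, ‖gradient Q' z‖ ≤ 3 * (R' / (4 * π) * (12 * V3)) := by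
    intro z
    have h := norm_fderiv_freePressure_le hF' h0' h1' z
    have hz : (1:ℝ) ≤ 1 + ‖z‖ := by linarith [norm_nonneg z]
    have hR : 0 ≤ R' := le_trans (by positivity) (h0' 0)
    have hle : 12 * V3 / (1 + ‖z‖) ≤ 12 * V3 := div_le_self (by positivity) hz
    have : ‖gradient Q' z‖ = ‖fderiv ℝ Q' z‖ := by unfold gradient; exact LinearIsometryEquiv.norm_map _ _
    rw [this]
    exact h.trans (mul_le_mul_of_nonneg_left (mul_le_mul_of_nonneg_left hle (by positivity)) (by norm_num))
  have hGb : ∀ z, ‖F z - gradient Q z‖ ≤ R + 3 * (R / (4 * π) * (12 * V3)) := fun z =>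
    (norm_sub_le _ _).trans (add_le_add (hFb z) (hDQ z))
  have hGb' : ∀ z, ‖F' z - gradient Q' z‖ ≤ R' + 3 * (R' / (4 * π) * (12 * V3)) := fun z =>
    (norm_sub_le _ _).trans (add_le_add (hFb' z) (hDQ' z))
  -- the projected datum of `F + tF′`
  have hproj : (fun x => (F x + t • F' x) - gradient (fun x => ∑ j : Fin 3,
      newtonGradPotential (EuclideanSpace.single j (1:ℝ)) (fun y => (F y + t • F' y) j) x) x) =
      fun x => (F x - gradient Q x) + t • (F' x - gradient Q' x) := by
    funext x
    rw [gradient_freePressure_add_smul hF hF' h0 h1 h0' h1' t x, smul_sub]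
    abel
  rw [hproj]
  exact freeResolvent_add_smul hGc hGb hGc' hGb' t α y

end Linear

end Summit.NavierStokesRegularity.NavierStokesRegularity.Theorems.KelvinGate

end
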